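import Literature.Analysis.Calculus.GlaeserSymmetricThree          -- ★ p851824: `exists_contDiff_comp_esymm_three_of_forall_perm` (+ primed parameter-free form)
import Literature.Analysis.Calculus.SmoothImplicitFunctionLocal    -- ★ `exists_smooth_implicitFunction_of_contDiffAt`
import Mathlib.Analysis.SpecialFunctions.Trigonometric.ArctanDeriv
import HarnessLib

/-!
# The CORNER CLASS EMBEDDING: near a scalar corner `(ζ, ζ, ζ)` of the torus `(S¹)³`, every smooth function of the real symmetric invariants of the angle offsets is a smooth function of the
# COMPLEX class data `(σ₁, σ₂, σ₃)` — an explicit rational chart, its rank, and the smooth left inverse (Glaeser 1963; Schwarz 1975 for `U(3)`; folklore IFT)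

Topic `Analysis/Calculus`; namespace `Literature.Analysis.Calculus`.  THEOREMS ONLY (no `def`, no instance, no notation, no axiom, no named fact, no `sorry`); Mathlib + ★ `GlaeserSymmetricThree` +
★ `SmoothImplicitFunctionLocal`; NO `Rogawski1990` import (the class triple is written out; it is ★ `esymm3 (chartEigG …)` by `rfl` downstream).  Cell `pub/hodgecm-mathlib`, crux H413
(`stmt-HodgeConjecture-24833`), road «N8-INNER» ROAD B: the lemma SHARED by (GT) «Glaeser on the torus» (LH10-p02 (g9)) and (C′) «corner EP package» (F0P3a-p03 (g25)) — dealer LH2-plan (g1)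
2026-09-02T16:27:29Z «ONE corner class-embedding lemma serves both».  Count-neutral.

THE MATHEMATICS.  Near a corner `θ = (θ₀, θ₀, θ₀)` the class data `σ(x) = (Σ_k e^{i(θ₀+x_k)}, Σ_{j<k} e^{i(θ₀+x_j)}e^{i(θ₀+x_k)}, Π_k e^{i(θ₀+x_k)})` of the angle offsets `x` are `S₃`-symmetric, so a symmetric
smooth germ `g(x, z)` and `σ(x)` both factor through the real invariants `e(x) = (e₁, e₂, e₃)(x)` (Glaeser); to write `g = F ∘ σ` with `F` smooth on an OPEN set of `ℂ³` one needs a smooth LEFT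
INVERSE of the induced map `e ↦ σ` — whose derivative cannot be read off an existentially produced factorisation.  The cure is the RATIONAL CHART `x_k = 2 arctan t_k`: then
`e^{i x_k} = (1 + i t_k)∕(1 − i t_k)`, so `ζ̄σ₁ = Σ_k ((1 − t_k²) + 2it_k)∕(1 + t_k²)` and `ζ̄³σ₃ = Π_k (…)` are EXPLICIT rational functions of `ε = esymm(t)`:
with `D = (1 − ε₂)² + (ε₁ − ε₃)² = Π_k (1 + t_k²)`,  `Re(ζ̄σ₁) = ((3 + ε₂)(1 − ε₂) + (ε₁ + 3ε₃)(ε₁ − ε₃))∕D`, `Im(ζ̄σ₁) = (2ε₁ − 6ε₃ + 2ε₁ε₂ + 2ε₂ε₃)∕D`, `Im(ζ̄³σ₃) = 2(1 − ε₂)(ε₁ − ε₃)∕D`.  This map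
`ψ : ℝ³ → ℝ³` has Jacobian `[[0, 4, 0], [2, 0, −6], [2, 0, −2]]` at `0` (determinant `−32`), so the smooth implicit function theorem inverts it near `0`; composing with the (linear) projection
`σ ↦ (Re ζ̄σ₁, Im ζ̄σ₁, Im ζ̄³σ₃)` gives a smooth `π` on an open `W ∋ σ⁰` of `ℂ³` with `π(σ(2 arctan t)) = ε(t)`; Glaeser once more (for the symmetric smooth map `t ↦ e(2 arctan t)`) converts
`ε(t)` into `e(x)`; and then `F := G ∘ (π × id)` for the Glaeser factor `G` of `g`.
* §1 `cexp_two_mul_arctan_mul_I` — the rational chart (`cos`, `sin` of `2 arctan t` inline).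
* §2 `re_sum_cexp_eq`, `im_sum_cexp_eq`, `im_prod_cexp_eq` — the three explicit rational identities in `ε(t)` (`field_simp; ring`).
* §3 the Jacobian of `ψ` at `0` along the three axes and as a continuous linear equivalence.
* §4 **`exists_contDiffOn_leftInverse_cornerClass_tan`** (left inverse in the `t`-chart), §5 **`exists_contDiffOn_leftInverse_cornerClass`** (in the angle offsets), §6 the shared head
  **`exists_contDiffOn_comp_cornerClass_of_forall_perm`**: a smooth `S₃`-symmetric `g : (Fin 3 → ℝ) × P → E` is `F ∘ (σ × id)` near `x = 0` with `F` smooth on `W × P`, `W ∋ σ⁰` open in `ℂ³`.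
HONEST LABEL: calculus plumbing; HC_CM is proved only modulo the 7 printed citations (2 remaining: hLiu418 = stmt-HodgeConjecture-24832, h413 = stmt-HodgeConjecture-24833) until rung 0 closes.

## References
* [Glaeser1963Newton] G. Glaeser, *Fonctions composées différentiables*, Ann. of Math. 77 (1963) 193–209, Thm. II.
* [Schwarz1975] G. W. Schwarz, *Smooth functions invariant under the action of a compact Lie group*, Topology 14 (1975) 63–68, Thm. 1 (the torus∕`U(3)` instance is what this file starts).
* [Dieudonne1960] J. Dieudonné, *Foundations of Modern Analysis* (1960), Ch. X §2 (implicit functions).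
-/

set_option autoImplicit false

noncomputable section

open Complex Set Function Filter Topology Metric Real
open scoped ContDiff

namespace Literature.Analysis.Calculus

/-! ## §1 The rational chart `x = 2 arctan t` -/

/-- **The chart**: `e^{i·2 arctan t} = cos + i sin` with the rational values of §1, i.e. `((1 − t²) + 2t·i) ∕ (1 + t²)` written with real coefficients. [cite: Glaeser1963Newton, Thm. II] -/
theorem cexp_two_mul_arctan_mul_I (t : ℝ) :
    Complex.exp (((2 * Real.arctan t : ℝ) : ℂ) * I) = (((1 - t ^ 2) / (1 + t ^ 2) : ℝ) : ℂ) + (((2 * t / (1 + t ^ 2) : ℝ)) : ℂ) * I := by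
  have h1 : 0 < 1 + t ^ 2 := by positivity
  -- `cos (2 arctan t) = (1 − t²)∕(1 + t²)` and `sin (2 arctan t) = 2t∕(1 + t²)` (the tree has these in two unrelated files; re-derived inline)
  have hcos : Real.cos (2 * Real.arctan t) = (1 - t ^ 2) / (1 + t ^ 2) := by
    rw [Real.cos_two_mul, Real.cos_sq_arctan]
    field_simp
    ring
  have hsin : Real.sin (2 * Real.arctan t) = 2 * t / (1 + t ^ 2) := by
    have hsq : Real.sqrt (1 + t ^ 2) * Real.sqrt (1 + t ^ 2) = 1 + t ^ 2 := Real.mul_self_sqrt h1.le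
    rw [Real.sin_two_mul, Real.sin_arctan, Real.cos_arctan]
    calc 2 * (t / Real.sqrt (1 + t ^ 2)) * (1 / Real.sqrt (1 + t ^ 2)) = 2 * t / (Real.sqrt (1 + t ^ 2) * Real.sqrt (1 + t ^ 2)) := by
          field_simp
      _ = 2 * t / (1 + t ^ 2) := by rw [hsq]
  rw [Complex.exp_mul_I, ← Complex.ofReal_cos, ← Complex.ofReal_sin, hcos, hsin]

/-- The angle `θ₀ + 2 arctan t` splits: `e^{i(θ₀ + x)} = e^{iθ₀} e^{ix}`. [cite: Glaeser1963Newton, Thm. II] -/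
theorem cexp_add_mul_I (θ₀ x : ℝ) : Complex.exp ((((θ₀ + x : ℝ)) : ℂ) * I) = Complex.exp ((θ₀ : ℂ) * I) * Complex.exp ((x : ℂ) * I) := by
  rw [Complex.ofReal_add, add_mul, Complex.exp_add]

/-- `ζ̄ ζ = 1` for `ζ = e^{iθ₀}`, in the form `conj ζ * ζ = 1`. [cite: Glaeser1963Newton, Thm. II] -/
theorem conj_cexp_mul_cexp (θ₀ : ℝ) : (starRingEnd ℂ) (Complex.exp ((θ₀ : ℂ) * I)) * Complex.exp ((θ₀ : ℂ) * I) = 1 := by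
  rw [← Complex.normSq_eq_conj_mul_self, ← Complex.sq_norm, Complex.norm_exp_ofReal_mul_I]
  norm_num

/-! ## §2 The three explicit rational identities -/

/-- **`Re ζ̄σ₁` in the chart**: `Σ_k (1 − t_k²)∕(1 + t_k²) = ((3 + ε₂)(1 − ε₂) + (ε₁ + 3ε₃)(ε₁ − ε₃)) ∕ ((1 − ε₂)² + (ε₁ − ε₃)²)` with `ε = esymm(t)` (and `(1 − ε₂)² + (ε₁ − ε₃)² = Π (1 + t_k²)`).
[cite: Glaeser1963Newton, Thm. II] -/
theorem sum_cos_chart_eq (t : Fin 3 → ℝ) :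
    (1 - t 0 ^ 2) / (1 + t 0 ^ 2) + (1 - t 1 ^ 2) / (1 + t 1 ^ 2) + (1 - t 2 ^ 2) / (1 + t 2 ^ 2) =
      ((3 + (t 0 * t 1 + t 0 * t 2 + t 1 * t 2)) * (1 - (t 0 * t 1 + t 0 * t 2 + t 1 * t 2)) +
          ((t 0 + t 1 + t 2) + 3 * (t 0 * t 1 * t 2)) * ((t 0 + t 1 + t 2) - t 0 * t 1 * t 2)) /
        ((1 - (t 0 * t 1 + t 0 * t 2 + t 1 * t 2)) ^ 2 + ((t 0 + t 1 + t 2) - t 0 * t 1 * t 2) ^ 2) := by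
  have h0 : (1 : ℝ) + t 0 ^ 2 ≠ 0 := by positivity
  have h1 : (1 : ℝ) + t 1 ^ 2 ≠ 0 := by positivity
  have h2 : (1 : ℝ) + t 2 ^ 2 ≠ 0 := by positivity
  have hD : (1 - (t 0 * t 1 + t 0 * t 2 + t 1 * t 2)) ^ 2 + ((t 0 + t 1 + t 2) - t 0 * t 1 * t 2) ^ 2 = (1 + t 0 ^ 2) * (1 + t 1 ^ 2) * (1 + t 2 ^ 2) := by ring
  rw [hD, div_add_div _ _ h0 h1, div_add_div _ _ (mul_ne_zero h0 h1) h2]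
  congr 1
  ring

/-- **`Im ζ̄σ₁` in the chart**: `Σ_k 2t_k∕(1 + t_k²) = (2ε₁ − 6ε₃ + 2ε₁ε₂ + 2ε₂ε₃) ∕ D`. [cite: Glaeser1963Newton, Thm. II] -/
theorem sum_sin_chart_eq (t : Fin 3 → ℝ) :
    2 * t 0 / (1 + t 0 ^ 2) + 2 * t 1 / (1 + t 1 ^ 2) + 2 * t 2 / (1 + t 2 ^ 2) =
      (2 * (t 0 + t 1 + t 2) - 6 * (t 0 * t 1 * t 2) + 2 * (t 0 + t 1 + t 2) * (t 0 * t 1 + t 0 * t 2 + t 1 * t 2) +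
          2 * (t 0 * t 1 + t 0 * t 2 + t 1 * t 2) * (t 0 * t 1 * t 2)) /
        ((1 - (t 0 * t 1 + t 0 * t 2 + t 1 * t 2)) ^ 2 + ((t 0 + t 1 + t 2) - t 0 * t 1 * t 2) ^ 2) := by
  have h0 : (1 : ℝ) + t 0 ^ 2 ≠ 0 := by positivity
  have h1 : (1 : ℝ) + t 1 ^ 2 ≠ 0 := by positivity
  have h2 : (1 : ℝ) + t 2 ^ 2 ≠ 0 := by positivity
  have hD : (1 - (t 0 * t 1 + t 0 * t 2 + t 1 * t 2)) ^ 2 + ((t 0 + t 1 + t 2) - t 0 * t 1 * t 2) ^ 2 = (1 + t 0 ^ 2) * (1 + t 1 ^ 2) * (1 + t 2 ^ 2) := by ring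
  rw [hD, div_add_div _ _ h0 h1, div_add_div _ _ (mul_ne_zero h0 h1) h2]
  congr 1
  ring

/-- **`Im ζ̄³σ₃` in the chart**: the imaginary part of `Π_k ((1 − t_k²) + 2t_k i)∕(1 + t_k²)` is `2(1 − ε₂)(ε₁ − ε₃) ∕ D`. [cite: Glaeser1963Newton, Thm. II] -/
theorem im_prod_chart_eq (t : Fin 3 → ℝ) :
    ((((((1 - t 0 ^ 2) / (1 + t 0 ^ 2) : ℝ)) : ℂ) + ((((2 * t 0 / (1 + t 0 ^ 2) : ℝ)) : ℂ)) * I) *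
        (((((1 - t 1 ^ 2) / (1 + t 1 ^ 2) : ℝ)) : ℂ) + ((((2 * t 1 / (1 + t 1 ^ 2) : ℝ)) : ℂ)) * I) *
        (((((1 - t 2 ^ 2) / (1 + t 2 ^ 2) : ℝ)) : ℂ) + ((((2 * t 2 / (1 + t 2 ^ 2) : ℝ)) : ℂ)) * I)).im =
      2 * (1 - (t 0 * t 1 + t 0 * t 2 + t 1 * t 2)) * ((t 0 + t 1 + t 2) - t 0 * t 1 * t 2) /
        ((1 - (t 0 * t 1 + t 0 * t 2 + t 1 * t 2)) ^ 2 + ((t 0 + t 1 + t 2) - t 0 * t 1 * t 2) ^ 2) := by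
  have h0 : (1 : ℝ) + t 0 ^ 2 ≠ 0 := by positivity
  have h1 : (1 : ℝ) + t 1 ^ 2 ≠ 0 := by positivity
  have h2 : (1 : ℝ) + t 2 ^ 2 ≠ 0 := by positivity
  have hD : (1 - (t 0 * t 1 + t 0 * t 2 + t 1 * t 2)) ^ 2 + ((t 0 + t 1 + t 2) - t 0 * t 1 * t 2) ^ 2 = (1 + t 0 ^ 2) * (1 + t 1 ^ 2) * (1 + t 2 ^ 2) := by ring
  simp only [Complex.mul_im, Complex.mul_re, Complex.add_re, Complex.add_im, Complex.ofReal_re, Complex.ofReal_im, Complex.I_re, Complex.I_im,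
    mul_zero, sub_zero, add_zero, zero_add, mul_one]
  rw [hD]
  field_simp
  ring

/-! ## §3 The Jacobian of the chart `ψ` at `0` -/

/-- Quotient rule at a point where the denominator is `1`: `d(u∕D) = du − u(0)·dD`. [cite: Dieudonne1960, Ch. VIII §2] -/
theorem hasFDerivAt_div_of_eq_one {u D : (Fin 3 → ℝ) → ℝ} {u' D' : (Fin 3 → ℝ) →L[ℝ] ℝ} {e : Fin 3 → ℝ} (hu : HasFDerivAt u u' e) (hD : HasFDerivAt D D' e) (h1 : D e = 1) :
    HasFDerivAt (fun e => u e / D e) (u' - u e • D') e := by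
  have hD0 : D e ≠ 0 := by rw [h1]; exact one_ne_zero
  have hinv : HasFDerivAt (fun e => (D e)⁻¹) ((-(D e ^ 2)⁻¹) • D') e := (hasDerivAt_inv hD0).comp_hasFDerivAt e hD
  have h : HasFDerivAt (fun e => u e * (D e)⁻¹) (u e • ((-(D e ^ 2)⁻¹) • D') + (D e)⁻¹ • u') e := hu.mul hinv
  have hfun : (fun e => u e * (D e)⁻¹) = fun e => u e / D e := by funext e; rw [div_eq_mul_inv]
  rw [hfun] at h
  refine h.congr_fderiv ?_
  ext v
  simp [h1]
  ring

/-- **THE JACOBIAN OF THE CORNER CHART AT `0`**: the explicit rational map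
`ψ(e) = (((3+e₁)(1−e₁) + (e₀+3e₂)(e₀−e₂))∕D, (2e₀ − 6e₂ + 2e₀e₁ + 2e₁e₂)∕D, 2(1−e₁)(e₀−e₂)∕D)`, `D = (1−e₁)² + (e₀−e₂)²`, has derivative `v ↦ (4v₁, 2v₀ − 6v₂, 2v₀ − 2v₂)` at `0`
(slot convention `e = (ε₁, ε₂, ε₃) = (e 0, e 1, e 2)`). [cite: Dieudonne1960, Ch. VIII §2] -/
theorem hasFDerivAt_cornerChart_zero :
    HasFDerivAt (fun e : Fin 3 → ℝ => (![((3 + e 1) * (1 - e 1) + (e 0 + 3 * e 2) * (e 0 - e 2)) / ((1 - e 1) ^ 2 + (e 0 - e 2) ^ 2),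
        (2 * e 0 - 6 * e 2 + 2 * e 0 * e 1 + 2 * e 1 * e 2) / ((1 - e 1) ^ 2 + (e 0 - e 2) ^ 2),
        2 * (1 - e 1) * (e 0 - e 2) / ((1 - e 1) ^ 2 + (e 0 - e 2) ^ 2)] : Fin 3 → ℝ))
      (ContinuousLinearMap.pi fun i : Fin 3 => (![(4 : ℝ) • (ContinuousLinearMap.proj 1 : (Fin 3 → ℝ) →L[ℝ] ℝ),
        (2 : ℝ) • (ContinuousLinearMap.proj 0 : (Fin 3 → ℝ) →L[ℝ] ℝ) - (6 : ℝ) • (ContinuousLinearMap.proj 2 : (Fin 3 → ℝ) →L[ℝ] ℝ),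
        (2 : ℝ) • (ContinuousLinearMap.proj 0 : (Fin 3 → ℝ) →L[ℝ] ℝ) - (2 : ℝ) • (ContinuousLinearMap.proj 2 : (Fin 3 → ℝ) →L[ℝ] ℝ)] : Fin 3 → ((Fin 3 → ℝ) →L[ℝ] ℝ)) i)
      0 := by
  -- coordinates
  have p0 : HasFDerivAt (fun e : Fin 3 → ℝ => e 0) (ContinuousLinearMap.proj 0 : (Fin 3 → ℝ) →L[ℝ] ℝ) (0 : Fin 3 → ℝ) := (ContinuousLinearMap.proj 0 : (Fin 3 → ℝ) →L[ℝ] ℝ).hasFDerivAt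
  have p1 : HasFDerivAt (fun e : Fin 3 → ℝ => e 1) (ContinuousLinearMap.proj 1 : (Fin 3 → ℝ) →L[ℝ] ℝ) (0 : Fin 3 → ℝ) := (ContinuousLinearMap.proj 1 : (Fin 3 → ℝ) →L[ℝ] ℝ).hasFDerivAt
  have p2 : HasFDerivAt (fun e : Fin 3 → ℝ => e 2) (ContinuousLinearMap.proj 2 : (Fin 3 → ℝ) →L[ℝ] ℝ) (0 : Fin 3 → ℝ) := (ContinuousLinearMap.proj 2 : (Fin 3 → ℝ) →L[ℝ] ℝ).hasFDerivAt
  -- the denominator: `D(0) = 1`, `dD(0) = −2·proj 1`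
  have hD : HasFDerivAt (fun e : Fin 3 → ℝ => (1 - e 1) ^ 2 + (e 0 - e 2) ^ 2) (-(2 : ℝ) • (ContinuousLinearMap.proj 1 : (Fin 3 → ℝ) →L[ℝ] ℝ)) (0 : Fin 3 → ℝ) := by
    have h : HasFDerivAt (fun e : Fin 3 → ℝ => (1 - e 1) * (1 - e 1) + (e 0 - e 2) * (e 0 - e 2)) _ (0 : Fin 3 → ℝ) :=
      ((p1.const_sub 1).mul (p1.const_sub 1)).add ((p0.sub p2).mul (p0.sub p2))
    have hfun : (fun e : Fin 3 → ℝ => (1 - e 1) * (1 - e 1) + (e 0 - e 2) * (e 0 - e 2)) = fun e => (1 - e 1) ^ 2 + (e 0 - e 2) ^ 2 := by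
      funext e; ring
    rw [hfun] at h
    refine h.congr_fderiv ?_
    ext v
    simp
    ring
  have hD1 : (fun e : Fin 3 → ℝ => (1 - e 1) ^ 2 + (e 0 - e 2) ^ 2) 0 = 1 := by simp
  -- the three numerators
  have hu1 : HasFDerivAt (fun e : Fin 3 → ℝ => (3 + e 1) * (1 - e 1) + (e 0 + 3 * e 2) * (e 0 - e 2)) (-(2 : ℝ) • (ContinuousLinearMap.proj 1 : (Fin 3 → ℝ) →L[ℝ] ℝ)) (0 : Fin 3 → ℝ) := by
    have h : HasFDerivAt (fun e : Fin 3 → ℝ => (3 + e 1) * (1 - e 1) + (e 0 + 3 * e 2) * (e 0 - e 2)) _ (0 : Fin 3 → ℝ) :=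
      ((p1.const_add 3).mul (p1.const_sub 1)).add ((p0.add (p2.const_mul 3)).mul (p0.sub p2))
    refine h.congr_fderiv ?_
    ext v
    simp
    ring
  have hu2 : HasFDerivAt (fun e : Fin 3 → ℝ => 2 * e 0 - 6 * e 2 + 2 * e 0 * e 1 + 2 * e 1 * e 2)
      ((2 : ℝ) • (ContinuousLinearMap.proj 0 : (Fin 3 → ℝ) →L[ℝ] ℝ) - (6 : ℝ) • (ContinuousLinearMap.proj 2 : (Fin 3 → ℝ) →L[ℝ] ℝ)) (0 : Fin 3 → ℝ) := by
    have h : HasFDerivAt (fun e : Fin 3 → ℝ => 2 * e 0 - 6 * e 2 + 2 * e 0 * e 1 + 2 * e 1 * e 2) _ (0 : Fin 3 → ℝ) :=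
      (((p0.const_mul 2).sub (p2.const_mul 6)).add ((p0.const_mul 2).mul p1)).add ((p1.const_mul 2).mul p2)
    refine h.congr_fderiv ?_
    ext v
    simp
  have hu3 : HasFDerivAt (fun e : Fin 3 → ℝ => 2 * (1 - e 1) * (e 0 - e 2)) ((2 : ℝ) • (ContinuousLinearMap.proj 0 : (Fin 3 → ℝ) →L[ℝ] ℝ) - (2 : ℝ) • (ContinuousLinearMap.proj 2 : (Fin 3 → ℝ) →L[ℝ] ℝ)) (0 : Fin 3 → ℝ) := by
    have h : HasFDerivAt (fun e : Fin 3 → ℝ => 2 * (1 - e 1) * (e 0 - e 2)) _ (0 : Fin 3 → ℝ) := ((p1.const_sub 1).const_mul 2).mul (p0.sub p2)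
    refine h.congr_fderiv ?_
    ext v
    simp
    ring
  -- the three quotients
  have hq1 := hasFDerivAt_div_of_eq_one hu1 hD hD1
  have hq2 := hasFDerivAt_div_of_eq_one hu2 hD hD1
  have hq3 := hasFDerivAt_div_of_eq_one hu3 hD hD1
  -- assemble
  rw [hasFDerivAt_pi']
  intro i
  fin_cases i
  · refine (hq1.congr_fderiv ?_)
    ext v
    simp
    ring
  · refine (hq2.congr_fderiv ?_)
    ext v
    simp
  · refine (hq3.congr_fderiv ?_)
    ext v
    simp

/-! ## §4 The smooth left inverse in the rational chart -/

/-- The Jacobian of §3 as a continuous linear AUTOMORPHISM of `ℝ³` (inverse rows `((3y₂ − y₁)∕4, y₀∕4, (y₂ − y₁)∕4)`; determinant `−32`). [cite: Dieudonne1960, Ch. VIII §2] -/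
theorem exists_continuousLinearEquiv_cornerChart :
    ∃ L : (Fin 3 → ℝ) ≃L[ℝ] (Fin 3 → ℝ), (L : (Fin 3 → ℝ) →L[ℝ] (Fin 3 → ℝ)) =
      ContinuousLinearMap.pi fun i : Fin 3 => (![(4 : ℝ) • (ContinuousLinearMap.proj 1 : (Fin 3 → ℝ) →L[ℝ] ℝ),
        (2 : ℝ) • (ContinuousLinearMap.proj 0 : (Fin 3 → ℝ) →L[ℝ] ℝ) - (6 : ℝ) • (ContinuousLinearMap.proj 2 : (Fin 3 → ℝ) →L[ℝ] ℝ),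
        (2 : ℝ) • (ContinuousLinearMap.proj 0 : (Fin 3 → ℝ) →L[ℝ] ℝ) - (2 : ℝ) • (ContinuousLinearMap.proj 2 : (Fin 3 → ℝ) →L[ℝ] ℝ)] : Fin 3 → ((Fin 3 → ℝ) →L[ℝ] ℝ)) i := by
  refine ⟨ContinuousLinearEquiv.equivOfInverse
    (ContinuousLinearMap.pi fun i : Fin 3 => (![(4 : ℝ) • (ContinuousLinearMap.proj 1 : (Fin 3 → ℝ) →L[ℝ] ℝ),
        (2 : ℝ) • (ContinuousLinearMap.proj 0 : (Fin 3 → ℝ) →L[ℝ] ℝ) - (6 : ℝ) • (ContinuousLinearMap.proj 2 : (Fin 3 → ℝ) →L[ℝ] ℝ),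
        (2 : ℝ) • (ContinuousLinearMap.proj 0 : (Fin 3 → ℝ) →L[ℝ] ℝ) - (2 : ℝ) • (ContinuousLinearMap.proj 2 : (Fin 3 → ℝ) →L[ℝ] ℝ)] : Fin 3 → ((Fin 3 → ℝ) →L[ℝ] ℝ)) i)
    (ContinuousLinearMap.pi fun i : Fin 3 => (![(4 : ℝ)⁻¹ • ((3 : ℝ) • (ContinuousLinearMap.proj 2 : (Fin 3 → ℝ) →L[ℝ] ℝ) - (ContinuousLinearMap.proj 1 : (Fin 3 → ℝ) →L[ℝ] ℝ)),
        (4 : ℝ)⁻¹ • (ContinuousLinearMap.proj 0 : (Fin 3 → ℝ) →L[ℝ] ℝ),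
        (4 : ℝ)⁻¹ • ((ContinuousLinearMap.proj 2 : (Fin 3 → ℝ) →L[ℝ] ℝ) - (ContinuousLinearMap.proj 1 : (Fin 3 → ℝ) →L[ℝ] ℝ))] : Fin 3 → ((Fin 3 → ℝ) →L[ℝ] ℝ)) i)
    (fun x => ?_) (fun y => ?_), rfl⟩
  · funext i
    fin_cases i <;> simp <;> ring
  · funext i
    fin_cases i <;> simp <;> ring

/-- **THE SMOOTH LEFT INVERSE OF THE CORNER CLASS MAP IN THE RATIONAL CHART.**  For every base angle `θ₀` there are an open `W ⊆ ℂ³` containing the corner class data `S(0) = (3ζ, 3ζ², ζ³)`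
(`ζ = e^{iθ₀}`; here `S(x) := (Σ_k e^{i(θ₀+x_k)}, Σ_{j<k} e^{i(θ₀+x_j)}e^{i(θ₀+x_k)}, Π_k e^{i(θ₀+x_k)})`), a map `πt : ℂ³ → ℝ³` of class `C^∞` on `W`, and `δ > 0` such that for every `t` with `‖t‖ < δ`
the class data `S(2 arctan t)` lie in `W` and `πt (S (2 arctan t)) = (ε₁, ε₂, ε₃)(t)` — the elementary symmetric functions of `t` (implicit function theorem on the chart of §3).
[cite: Dieudonne1960, Ch. X §2 (10.2.1)] [cite: Glaeser1963Newton, Thm. II] -/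
theorem exists_contDiffOn_leftInverse_cornerClass_tan (θ₀ : ℝ) :
    ∃ W : Set (ℂ × ℂ × ℂ), IsOpen W ∧
      ((Complex.exp ((((θ₀ + 0 : ℝ)) : ℂ) * I) + Complex.exp ((((θ₀ + 0 : ℝ)) : ℂ) * I) + Complex.exp ((((θ₀ + 0 : ℝ)) : ℂ) * I),
        Complex.exp ((((θ₀ + 0 : ℝ)) : ℂ) * I) * Complex.exp ((((θ₀ + 0 : ℝ)) : ℂ) * I) + Complex.exp ((((θ₀ + 0 : ℝ)) : ℂ) * I) * Complex.exp ((((θ₀ + 0 : ℝ)) : ℂ) * I) +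
          Complex.exp ((((θ₀ + 0 : ℝ)) : ℂ) * I) * Complex.exp ((((θ₀ + 0 : ℝ)) : ℂ) * I),
        Complex.exp ((((θ₀ + 0 : ℝ)) : ℂ) * I) * Complex.exp ((((θ₀ + 0 : ℝ)) : ℂ) * I) * Complex.exp ((((θ₀ + 0 : ℝ)) : ℂ) * I)) : ℂ × ℂ × ℂ) ∈ W ∧
      ∃ πt : ℂ × ℂ × ℂ → (Fin 3 → ℝ), ContDiffOn ℝ ∞ πt W ∧ ∃ δ > (0 : ℝ), ∀ t : Fin 3 → ℝ, ‖t‖ < δ →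
        ((Complex.exp ((((θ₀ + 2 * Real.arctan (t 0) : ℝ)) : ℂ) * I) + Complex.exp ((((θ₀ + 2 * Real.arctan (t 1) : ℝ)) : ℂ) * I) + Complex.exp ((((θ₀ + 2 * Real.arctan (t 2) : ℝ)) : ℂ) * I),
          Complex.exp ((((θ₀ + 2 * Real.arctan (t 0) : ℝ)) : ℂ) * I) * Complex.exp ((((θ₀ + 2 * Real.arctan (t 1) : ℝ)) : ℂ) * I) +
              Complex.exp ((((θ₀ + 2 * Real.arctan (t 0) : ℝ)) : ℂ) * I) * Complex.exp ((((θ₀ + 2 * Real.arctan (t 2) : ℝ)) : ℂ) * I) +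
            Complex.exp ((((θ₀ + 2 * Real.arctan (t 1) : ℝ)) : ℂ) * I) * Complex.exp ((((θ₀ + 2 * Real.arctan (t 2) : ℝ)) : ℂ) * I),
          Complex.exp ((((θ₀ + 2 * Real.arctan (t 0) : ℝ)) : ℂ) * I) * Complex.exp ((((θ₀ + 2 * Real.arctan (t 1) : ℝ)) : ℂ) * I) *
            Complex.exp ((((θ₀ + 2 * Real.arctan (t 2) : ℝ)) : ℂ) * I)) : ℂ × ℂ × ℂ) ∈ W ∧
        πt ((Complex.exp ((((θ₀ + 2 * Real.arctan (t 0) : ℝ)) : ℂ) * I) + Complex.exp ((((θ₀ + 2 * Real.arctan (t 1) : ℝ)) : ℂ) * I) + Complex.exp ((((θ₀ + 2 * Real.arctan (t 2) : ℝ)) : ℂ) * I),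
          Complex.exp ((((θ₀ + 2 * Real.arctan (t 0) : ℝ)) : ℂ) * I) * Complex.exp ((((θ₀ + 2 * Real.arctan (t 1) : ℝ)) : ℂ) * I) +
              Complex.exp ((((θ₀ + 2 * Real.arctan (t 0) : ℝ)) : ℂ) * I) * Complex.exp ((((θ₀ + 2 * Real.arctan (t 2) : ℝ)) : ℂ) * I) +
            Complex.exp ((((θ₀ + 2 * Real.arctan (t 1) : ℝ)) : ℂ) * I) * Complex.exp ((((θ₀ + 2 * Real.arctan (t 2) : ℝ)) : ℂ) * I),
          Complex.exp ((((θ₀ + 2 * Real.arctan (t 0) : ℝ)) : ℂ) * I) * Complex.exp ((((θ₀ + 2 * Real.arctan (t 1) : ℝ)) : ℂ) * I) *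
            Complex.exp ((((θ₀ + 2 * Real.arctan (t 2) : ℝ)) : ℂ) * I)) : ℂ × ℂ × ℂ) =
          ![t 0 + t 1 + t 2, t 0 * t 1 + t 0 * t 2 + t 1 * t 2, t 0 * t 1 * t 2] := by
  -- notation: the class data `S x`, `ζ`, the projection `proj`, the chart `ψ`, the invariants `ε`
  set ζ : ℂ := Complex.exp ((θ₀ : ℂ) * I) with hζ
  set S : (Fin 3 → ℝ) → ℂ × ℂ × ℂ := fun x =>
    (Complex.exp ((((θ₀ + x 0 : ℝ)) : ℂ) * I) + Complex.exp ((((θ₀ + x 1 : ℝ)) : ℂ) * I) + Complex.exp ((((θ₀ + x 2 : ℝ)) : ℂ) * I),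
      Complex.exp ((((θ₀ + x 0 : ℝ)) : ℂ) * I) * Complex.exp ((((θ₀ + x 1 : ℝ)) : ℂ) * I) +
          Complex.exp ((((θ₀ + x 0 : ℝ)) : ℂ) * I) * Complex.exp ((((θ₀ + x 2 : ℝ)) : ℂ) * I) +
        Complex.exp ((((θ₀ + x 1 : ℝ)) : ℂ) * I) * Complex.exp ((((θ₀ + x 2 : ℝ)) : ℂ) * I),
      Complex.exp ((((θ₀ + x 0 : ℝ)) : ℂ) * I) * Complex.exp ((((θ₀ + x 1 : ℝ)) : ℂ) * I) * Complex.exp ((((θ₀ + x 2 : ℝ)) : ℂ) * I)) with hS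
  set proj : ℂ × ℂ × ℂ → (Fin 3 → ℝ) := fun σ => ![(σ.1 * (starRingEnd ℂ) ζ).re, (σ.1 * (starRingEnd ℂ) ζ).im, (σ.2.2 * (starRingEnd ℂ) ζ ^ 3).im] with hproj
  set ψ : (Fin 3 → ℝ) → (Fin 3 → ℝ) := fun e => ![((3 + e 1) * (1 - e 1) + (e 0 + 3 * e 2) * (e 0 - e 2)) / ((1 - e 1) ^ 2 + (e 0 - e 2) ^ 2),
        (2 * e 0 - 6 * e 2 + 2 * e 0 * e 1 + 2 * e 1 * e 2) / ((1 - e 1) ^ 2 + (e 0 - e 2) ^ 2),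
        2 * (1 - e 1) * (e 0 - e 2) / ((1 - e 1) ^ 2 + (e 0 - e 2) ^ 2)] with hψ
  set ε : (Fin 3 → ℝ) → (Fin 3 → ℝ) := fun t => ![t 0 + t 1 + t 2, t 0 * t 1 + t 0 * t 2 + t 1 * t 2, t 0 * t 1 * t 2] with hε
  -- (1) the KEY identity `proj (S (2 arctan t)) = ψ (ε t)`
  have hconj : ∀ x : ℝ, Complex.exp ((((θ₀ + x : ℝ)) : ℂ) * I) * (starRingEnd ℂ) ζ = Complex.exp ((x : ℂ) * I) := by
    intro x
    rw [cexp_add_mul_I, hζ, mul_comm (Complex.exp _) (Complex.exp _), mul_assoc, mul_comm (Complex.exp ((θ₀ : ℂ) * I)), conj_cexp_mul_cexp, mul_one]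
  have hkey : ∀ t : Fin 3 → ℝ, proj (S fun k => 2 * Real.arctan (t k)) = ψ (ε t) := by
    intro t
    have hk : ∀ k : Fin 3, Complex.exp ((((θ₀ + 2 * Real.arctan (t k) : ℝ)) : ℂ) * I) * (starRingEnd ℂ) ζ =
        (((1 - t k ^ 2) / (1 + t k ^ 2) : ℝ) : ℂ) + ((((2 * t k / (1 + t k ^ 2) : ℝ)) : ℂ)) * I := fun k => by
      rw [hconj, cexp_two_mul_arctan_mul_I]
    have h1 : (S fun k => 2 * Real.arctan (t k)).1 * (starRingEnd ℂ) ζ =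
        ((((1 - t 0 ^ 2) / (1 + t 0 ^ 2) : ℝ) : ℂ) + ((((2 * t 0 / (1 + t 0 ^ 2) : ℝ)) : ℂ)) * I) +
        ((((1 - t 1 ^ 2) / (1 + t 1 ^ 2) : ℝ) : ℂ) + ((((2 * t 1 / (1 + t 1 ^ 2) : ℝ)) : ℂ)) * I) +
        ((((1 - t 2 ^ 2) / (1 + t 2 ^ 2) : ℝ) : ℂ) + ((((2 * t 2 / (1 + t 2 ^ 2) : ℝ)) : ℂ)) * I) := by
      simp only [hS, add_mul, hk]
    have h3 : (S fun k => 2 * Real.arctan (t k)).2.2 * (starRingEnd ℂ) ζ ^ 3 =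
        ((((1 - t 0 ^ 2) / (1 + t 0 ^ 2) : ℝ) : ℂ) + ((((2 * t 0 / (1 + t 0 ^ 2) : ℝ)) : ℂ)) * I) *
        ((((1 - t 1 ^ 2) / (1 + t 1 ^ 2) : ℝ) : ℂ) + ((((2 * t 1 / (1 + t 1 ^ 2) : ℝ)) : ℂ)) * I) *
        ((((1 - t 2 ^ 2) / (1 + t 2 ^ 2) : ℝ) : ℂ) + ((((2 * t 2 / (1 + t 2 ^ 2) : ℝ)) : ℂ)) * I) := by
      rw [← hk 0, ← hk 1, ← hk 2]
      simp only [hS]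
      ring
    have hre : ∀ a b : ℝ, (((a : ℂ)) + ((b : ℂ)) * I).re = a := by intro a b; simp
    have him : ∀ a b : ℝ, (((a : ℂ)) + ((b : ℂ)) * I).im = b := by intro a b; simp
    have hA : ((S fun k => 2 * Real.arctan (t k)).1 * (starRingEnd ℂ) ζ).re =
        ((3 + (t 0 * t 1 + t 0 * t 2 + t 1 * t 2)) * (1 - (t 0 * t 1 + t 0 * t 2 + t 1 * t 2)) +
            ((t 0 + t 1 + t 2) + 3 * (t 0 * t 1 * t 2)) * ((t 0 + t 1 + t 2) - t 0 * t 1 * t 2)) /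
          ((1 - (t 0 * t 1 + t 0 * t 2 + t 1 * t 2)) ^ 2 + ((t 0 + t 1 + t 2) - t 0 * t 1 * t 2) ^ 2) := by
      rw [h1, Complex.add_re, Complex.add_re, hre, hre, hre, sum_cos_chart_eq]
    have hB : ((S fun k => 2 * Real.arctan (t k)).1 * (starRingEnd ℂ) ζ).im =
        (2 * (t 0 + t 1 + t 2) - 6 * (t 0 * t 1 * t 2) + 2 * (t 0 + t 1 + t 2) * (t 0 * t 1 + t 0 * t 2 + t 1 * t 2) +
            2 * (t 0 * t 1 + t 0 * t 2 + t 1 * t 2) * (t 0 * t 1 * t 2)) /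
          ((1 - (t 0 * t 1 + t 0 * t 2 + t 1 * t 2)) ^ 2 + ((t 0 + t 1 + t 2) - t 0 * t 1 * t 2) ^ 2) := by
      rw [h1, Complex.add_im, Complex.add_im, him, him, him, sum_sin_chart_eq]
    have hC : ((S fun k => 2 * Real.arctan (t k)).2.2 * (starRingEnd ℂ) ζ ^ 3).im =
        2 * (1 - (t 0 * t 1 + t 0 * t 2 + t 1 * t 2)) * ((t 0 + t 1 + t 2) - t 0 * t 1 * t 2) /
          ((1 - (t 0 * t 1 + t 0 * t 2 + t 1 * t 2)) ^ 2 + ((t 0 + t 1 + t 2) - t 0 * t 1 * t 2) ^ 2) := by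
      rw [h3, im_prod_chart_eq]
    simp only [hproj, hψ, hε, Matrix.cons_val_zero, Matrix.cons_val_one, Matrix.cons_val_two, Matrix.head_cons, Matrix.tail_cons, hA, hB, hC]
  -- (2) smoothness: `proj` is smooth (linear), `ψ` is smooth where the denominator does not vanish, `ε` is smooth
  have hproj_s : ContDiff ℝ ∞ proj := by
    refine contDiff_pi.2 fun i => ?_
    fin_cases i
    · exact Complex.reCLM.contDiff.comp (contDiff_fst.mul contDiff_const)
    · exact Complex.imCLM.contDiff.comp (contDiff_fst.mul contDiff_const)
    · exact Complex.imCLM.contDiff.comp ((contDiff_snd.comp contDiff_snd).mul contDiff_const)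
  have hε_s : ContDiff ℝ ∞ ε := by
    refine contDiff_pi.2 fun i => ?_
    fin_cases i
    · exact ((contDiff_apply ℝ ℝ 0).add (contDiff_apply ℝ ℝ 1)).add (contDiff_apply ℝ ℝ 2)
    · exact (((contDiff_apply ℝ ℝ 0).mul (contDiff_apply ℝ ℝ 1)).add ((contDiff_apply ℝ ℝ 0).mul (contDiff_apply ℝ ℝ 2))).add
        ((contDiff_apply ℝ ℝ 1).mul (contDiff_apply ℝ ℝ 2))
    · exact ((contDiff_apply ℝ ℝ 0).mul (contDiff_apply ℝ ℝ 1)).mul (contDiff_apply ℝ ℝ 2)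
  set Dset : Set (Fin 3 → ℝ) := {e | (1 - e 1) ^ 2 + (e 0 - e 2) ^ 2 ≠ 0} with hDset
  have hDc : Continuous fun e : Fin 3 → ℝ => (1 - e 1) ^ 2 + (e 0 - e 2) ^ 2 := by fun_prop
  have hDopen : IsOpen Dset := isOpen_ne_fun hDc continuous_const
  have hD0 : (0 : Fin 3 → ℝ) ∈ Dset := by simp [hDset]
  have hψ_s : ∀ e ∈ Dset, ContDiffAt ℝ ∞ ψ e := by
    intro e he
    have hd : ContDiffAt ℝ ∞ (fun e : Fin 3 → ℝ => (1 - e 1) ^ 2 + (e 0 - e 2) ^ 2) e := by fun_prop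
    refine contDiffAt_pi.2 fun i => ?_
    fin_cases i
    · exact (ContDiffAt.div (by fun_prop) hd he)
    · exact (ContDiffAt.div (by fun_prop) hd he)
    · exact (ContDiffAt.div (by fun_prop) hd he)
  -- (3) the implicit function theorem for `G (y, e) := ψ e − y`
  obtain ⟨L, hL⟩ := exists_continuousLinearEquiv_cornerChart
  have hψd : HasFDerivAt ψ (L : (Fin 3 → ℝ) →L[ℝ] (Fin 3 → ℝ)) 0 := by rw [hL]; exact hasFDerivAt_cornerChart_zero
  set G : (Fin 3 → ℝ) × (Fin 3 → ℝ) → (Fin 3 → ℝ) := fun q => ψ q.2 - q.1 with hG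
  have hGs : ∀ q ∈ (Set.univ : Set (Fin 3 → ℝ)) ×ˢ Dset, ContDiffAt ℝ ∞ G q := by
    rintro ⟨y, e⟩ ⟨-, he⟩
    exact ((hψ_s e he).comp (y, e) contDiffAt_snd).sub contDiffAt_fst
  have hG0 : G (ψ 0, 0) = 0 := by simp [hG]
  have hGd : (fderiv ℝ G (ψ 0, 0)).comp (ContinuousLinearMap.inr ℝ (Fin 3 → ℝ) (Fin 3 → ℝ)) = (L : (Fin 3 → ℝ) →L[ℝ] (Fin 3 → ℝ)) := by
    have hsnd : HasFDerivAt (fun q : (Fin 3 → ℝ) × (Fin 3 → ℝ) => q.2) (ContinuousLinearMap.snd ℝ (Fin 3 → ℝ) (Fin 3 → ℝ)) (ψ 0, (0 : Fin 3 → ℝ)) :=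
      hasFDerivAt_snd
    have hfst : HasFDerivAt (fun q : (Fin 3 → ℝ) × (Fin 3 → ℝ) => q.1) (ContinuousLinearMap.fst ℝ (Fin 3 → ℝ) (Fin 3 → ℝ)) (ψ 0, (0 : Fin 3 → ℝ)) :=
      hasFDerivAt_fst
    have hψd' : HasFDerivAt ψ (L : (Fin 3 → ℝ) →L[ℝ] (Fin 3 → ℝ)) ((ψ 0, (0 : Fin 3 → ℝ)) : (Fin 3 → ℝ) × (Fin 3 → ℝ)).2 := hψd
    have h : HasFDerivAt G ((L : (Fin 3 → ℝ) →L[ℝ] (Fin 3 → ℝ)).comp (ContinuousLinearMap.snd ℝ (Fin 3 → ℝ) (Fin 3 → ℝ)) -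
        ContinuousLinearMap.fst ℝ (Fin 3 → ℝ) (Fin 3 → ℝ)) (ψ 0, 0) :=
      (HasFDerivAt.comp ((ψ 0, (0 : Fin 3 → ℝ)) : (Fin 3 → ℝ) × (Fin 3 → ℝ)) hψd' hsnd).sub hfst
    rw [h.fderiv]
    ext v i
    simp
  obtain ⟨ρ₁, hρ₁, ρ₂, hρ₂, χ, hχs, hχ0, hχball, hχzero, hχuniq⟩ :=
    exists_smooth_implicitFunction_of_contDiffAt G (ψ 0) 0 ((Set.univ : Set (Fin 3 → ℝ)) ×ˢ Dset) (isOpen_univ.prod hDopen) ⟨mem_univ _, hD0⟩ hGs hG0 L hGd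
  -- (4) the neighbourhood `W := proj⁻¹ (ball (ψ 0) ρ₁)` and `π := χ ∘ proj`
  refine ⟨proj ⁻¹' Metric.ball (ψ 0) ρ₁, Metric.isOpen_ball.preimage hproj_s.continuous, ?_, fun σ => χ (proj σ), ?_, ?_⟩
  · -- the corner itself: `S 0`, `proj (S 0) = ψ (ε 0) = ψ 0`
    have h := hkey 0
    have e0 : ε 0 = 0 := by funext i; fin_cases i <;> simp [hε]
    have harc : (fun k : Fin 3 => 2 * Real.arctan ((0 : Fin 3 → ℝ) k)) = fun _ => 0 := by funext k; simp
    rw [harc, e0] at h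
    show proj (S fun _ => 0) ∈ Metric.ball (ψ 0) ρ₁
    rw [show (S fun _ => (0 : ℝ)) = S (fun k : Fin 3 => 2 * Real.arctan ((0 : Fin 3 → ℝ) k)) by rw [harc]] at *
    rw [harc] at h ⊢
    rw [h]
    exact Metric.mem_ball_self hρ₁
  · exact hχs.comp hproj_s.contDiffOn fun σ hσ => hσ
  · -- `δ`: continuity of `t ↦ ψ (ε t)` and of `ε` at `0`
    have hcont1 : ContinuousAt (fun t => ψ (ε t)) 0 := by
      have hε0 : ε 0 = 0 := by funext i; fin_cases i <;> simp [hε]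
      have h := (hψ_s 0 hD0).continuousAt
      rw [← hε0] at h
      exact h.comp hε_s.continuous.continuousAt
    have hcont2 : ContinuousAt ε 0 := hε_s.continuous.continuousAt
    have hε0 : ε 0 = 0 := by funext i; fin_cases i <;> simp [hε]
    have hm1 : (fun t => ψ (ε t)) ⁻¹' Metric.ball (ψ 0) ρ₁ ∈ 𝓝 (0 : Fin 3 → ℝ) :=
      hcont1.preimage_mem_nhds (by rw [hε0]; exact Metric.isOpen_ball.mem_nhds (Metric.mem_ball_self hρ₁))
    have hm2 : ε ⁻¹' Metric.ball 0 ρ₂ ∈ 𝓝 (0 : Fin 3 → ℝ) := hcont2.preimage_mem_nhds (by rw [hε0]; exact Metric.isOpen_ball.mem_nhds (Metric.mem_ball_self hρ₂))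
    obtain ⟨δ, hδ, hball⟩ := Metric.mem_nhds_iff.1 (Filter.inter_mem hm1 hm2)
    refine ⟨δ, hδ, fun t ht => ?_⟩
    have htb : t ∈ Metric.ball (0 : Fin 3 → ℝ) δ := by rwa [Metric.mem_ball, dist_zero_right]
    obtain ⟨h1, h2⟩ := hball htb
    have hpS : proj (S fun k => 2 * Real.arctan (t k)) = ψ (ε t) := hkey t
    refine ⟨?_, ?_⟩
    · show proj (S fun k => 2 * Real.arctan (t k)) ∈ Metric.ball (ψ 0) ρ₁
      rw [hpS]; exact h1
    · show χ (proj (S fun k => 2 * Real.arctan (t k))) = ε t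
      rw [hpS]
      exact (hχuniq (ψ (ε t)) h1 (ε t) h2 (by simp [hG])).symm

/-! ## §5 The left inverse in the angle offsets, and the shared factorisation head -/

/-- The symmetric triple `e(x) = (Σx, Σxx′, Πx)` is invariant under slot permutations. [cite: Glaeser1963Newton, Thm. II] -/
theorem esymmVec_comp_perm (x : Fin 3 → ℝ) (σ : Equiv.Perm (Fin 3)) :
    (![(x ∘ σ) 0 + (x ∘ σ) 1 + (x ∘ σ) 2, (x ∘ σ) 0 * (x ∘ σ) 1 + (x ∘ σ) 0 * (x ∘ σ) 2 + (x ∘ σ) 1 * (x ∘ σ) 2, (x ∘ σ) 0 * (x ∘ σ) 1 * (x ∘ σ) 2] : Fin 3 → ℝ) =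
      ![x 0 + x 1 + x 2, x 0 * x 1 + x 0 * x 2 + x 1 * x 2, x 0 * x 1 * x 2] := by
  have h1 : ∑ i, x (σ i) = ∑ i, x i := Equiv.sum_comp σ x
  have h2 : ∑ i, x (σ i) ^ 2 = ∑ i, x i ^ 2 := Equiv.sum_comp σ (fun i => x i ^ 2)
  have h3 : ∏ i, x (σ i) = ∏ i, x i := Equiv.prod_comp σ x
  simp only [Fin.sum_univ_three, Fin.prod_univ_three] at h1 h2 h3
  simp only [Function.comp_apply]
  have h2' : x (σ 0) * x (σ 1) + x (σ 0) * x (σ 2) + x (σ 1) * x (σ 2) = x 0 * x 1 + x 0 * x 2 + x 1 * x 2 := by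
    linear_combination (1 / 2 : ℝ) * (x (σ 0) + x (σ 1) + x (σ 2) + (x 0 + x 1 + x 2)) * h1 - (1 / 2 : ℝ) * h2
  rw [h1, h2', h3]

universe u

variable {P : Type u} [NormedAddCommGroup P] [NormedSpace ℝ P] [FiniteDimensional ℝ P]
  {E : Type u} [NormedAddCommGroup E] [NormedSpace ℝ E] [CompleteSpace E]

/-- **THE SHARED HEAD — SMOOTH SYMMETRIC GERMS AT A SCALAR CORNER FACTOR THROUGH THE COMPLEX CLASS DATA.**  For every base angle `θ₀` and every `C^∞`, `S₃`-symmetric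
`g : (Fin 3 → ℝ) × P → E` (finite-dimensional real parameters `P`, Banach `E`; the universe frame of ★ `GlaeserSymmetricThree`) there are an open `W ⊆ ℂ³` containing the corner class data
`S(0)`, a function `F : ℂ³ × P → E` of class `C^∞` on `W × P`, and `δ > 0` with **`F (S x, z) = g (x, z)` whenever `‖x‖ < δ`**, where
`S(x) = (Σ_k e^{i(θ₀+x_k)}, Σ_{j<k} e^{i(θ₀+x_j)}e^{i(θ₀+x_k)}, Π_k e^{i(θ₀+x_k)})`.  (★ Glaeser-`S₃` in the rational chart `x = 2 arctan t`, composed with §4's smooth left inverse; (C′) reads it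
with `g :=` the symmetrised compact reading in angle offsets, (GT) as its corner local model.) [cite: Glaeser1963Newton, Thm. II] [cite: Schwarz1975, Thm. 1] [cite: Dieudonne1960, Ch. X §2] -/
theorem exists_contDiffOn_comp_cornerClass_of_forall_perm (θ₀ : ℝ) (g : (Fin 3 → ℝ) × P → E) (hg : ContDiff ℝ ∞ g)
    (hsymm : ∀ (σ : Equiv.Perm (Fin 3)) (x : Fin 3 → ℝ) (z : P), g (x ∘ σ, z) = g (x, z)) :
    ∃ W : Set (ℂ × ℂ × ℂ), IsOpen W ∧
      ((Complex.exp ((((θ₀ + 0 : ℝ)) : ℂ) * I) + Complex.exp ((((θ₀ + 0 : ℝ)) : ℂ) * I) + Complex.exp ((((θ₀ + 0 : ℝ)) : ℂ) * I),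
        Complex.exp ((((θ₀ + 0 : ℝ)) : ℂ) * I) * Complex.exp ((((θ₀ + 0 : ℝ)) : ℂ) * I) + Complex.exp ((((θ₀ + 0 : ℝ)) : ℂ) * I) * Complex.exp ((((θ₀ + 0 : ℝ)) : ℂ) * I) +
          Complex.exp ((((θ₀ + 0 : ℝ)) : ℂ) * I) * Complex.exp ((((θ₀ + 0 : ℝ)) : ℂ) * I),
        Complex.exp ((((θ₀ + 0 : ℝ)) : ℂ) * I) * Complex.exp ((((θ₀ + 0 : ℝ)) : ℂ) * I) * Complex.exp ((((θ₀ + 0 : ℝ)) : ℂ) * I)) : ℂ × ℂ × ℂ) ∈ W ∧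
      ∃ F : (ℂ × ℂ × ℂ) × P → E, ContDiffOn ℝ ∞ F (W ×ˢ Set.univ) ∧ ∃ δ > (0 : ℝ), ∀ x : Fin 3 → ℝ, ‖x‖ < δ → ∀ z : P,
        ((Complex.exp ((((θ₀ + x 0 : ℝ)) : ℂ) * I) + Complex.exp ((((θ₀ + x 1 : ℝ)) : ℂ) * I) + Complex.exp ((((θ₀ + x 2 : ℝ)) : ℂ) * I),
          Complex.exp ((((θ₀ + x 0 : ℝ)) : ℂ) * I) * Complex.exp ((((θ₀ + x 1 : ℝ)) : ℂ) * I) +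
              Complex.exp ((((θ₀ + x 0 : ℝ)) : ℂ) * I) * Complex.exp ((((θ₀ + x 2 : ℝ)) : ℂ) * I) +
            Complex.exp ((((θ₀ + x 1 : ℝ)) : ℂ) * I) * Complex.exp ((((θ₀ + x 2 : ℝ)) : ℂ) * I),
          Complex.exp ((((θ₀ + x 0 : ℝ)) : ℂ) * I) * Complex.exp ((((θ₀ + x 1 : ℝ)) : ℂ) * I) * Complex.exp ((((θ₀ + x 2 : ℝ)) : ℂ) * I)) : ℂ × ℂ × ℂ) ∈ W ∧
        F ((Complex.exp ((((θ₀ + x 0 : ℝ)) : ℂ) * I) + Complex.exp ((((θ₀ + x 1 : ℝ)) : ℂ) * I) + Complex.exp ((((θ₀ + x 2 : ℝ)) : ℂ) * I),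
          Complex.exp ((((θ₀ + x 0 : ℝ)) : ℂ) * I) * Complex.exp ((((θ₀ + x 1 : ℝ)) : ℂ) * I) +
              Complex.exp ((((θ₀ + x 0 : ℝ)) : ℂ) * I) * Complex.exp ((((θ₀ + x 2 : ℝ)) : ℂ) * I) +
            Complex.exp ((((θ₀ + x 1 : ℝ)) : ℂ) * I) * Complex.exp ((((θ₀ + x 2 : ℝ)) : ℂ) * I),
          Complex.exp ((((θ₀ + x 0 : ℝ)) : ℂ) * I) * Complex.exp ((((θ₀ + x 1 : ℝ)) : ℂ) * I) * Complex.exp ((((θ₀ + x 2 : ℝ)) : ℂ) * I)), z) = g (x, z) := by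
  set S : (Fin 3 → ℝ) → ℂ × ℂ × ℂ := fun x =>
    (Complex.exp ((((θ₀ + x 0 : ℝ)) : ℂ) * I) + Complex.exp ((((θ₀ + x 1 : ℝ)) : ℂ) * I) + Complex.exp ((((θ₀ + x 2 : ℝ)) : ℂ) * I),
      Complex.exp ((((θ₀ + x 0 : ℝ)) : ℂ) * I) * Complex.exp ((((θ₀ + x 1 : ℝ)) : ℂ) * I) +
          Complex.exp ((((θ₀ + x 0 : ℝ)) : ℂ) * I) * Complex.exp ((((θ₀ + x 2 : ℝ)) : ℂ) * I) +
        Complex.exp ((((θ₀ + x 1 : ℝ)) : ℂ) * I) * Complex.exp ((((θ₀ + x 2 : ℝ)) : ℂ) * I),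
      Complex.exp ((((θ₀ + x 0 : ℝ)) : ℂ) * I) * Complex.exp ((((θ₀ + x 1 : ℝ)) : ℂ) * I) * Complex.exp ((((θ₀ + x 2 : ℝ)) : ℂ) * I)) with hS
  -- §4: the left inverse in the `t`-chart
  obtain ⟨W, hWo, hW0, πt, hπs, δ, hδ, hπ⟩ := exists_contDiffOn_leftInverse_cornerClass_tan θ₀
  -- the germ in the `t`-chart and its Glaeser factorisation through `ε(t)`
  set gt : (Fin 3 → ℝ) × P → E := fun q => g (fun k => 2 * Real.arctan (q.1 k), q.2) with hgt
  have harc : ContDiff ℝ ∞ fun t : Fin 3 → ℝ => (fun k => 2 * Real.arctan (t k) : Fin 3 → ℝ) :=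
    contDiff_pi.2 fun k => contDiff_const.mul (Real.contDiff_arctan.comp (contDiff_apply ℝ ℝ k))
  have hgts : ContDiff ℝ ∞ gt := hg.comp ((harc.comp contDiff_fst).prodMk contDiff_snd)
  have hgtsymm : ∀ (σ : Equiv.Perm (Fin 3)) (t : Fin 3 → ℝ) (z : P), gt (t ∘ σ, z) = gt (t, z) := by
    intro σ t z
    simp only [hgt]
    have : (fun k => 2 * Real.arctan ((t ∘ σ) k)) = (fun k => 2 * Real.arctan (t k)) ∘ σ := by funext k; rfl
    rw [this, hsymm]
  obtain ⟨G, hGs, hG⟩ := exists_contDiff_comp_esymm_three_of_forall_perm gt hgts hgtsymm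
  -- `F := G ∘ (πt × id)` on `W × P`
  refine ⟨W, hWo, hW0, fun q => G (πt q.1, q.2), ?_, ?_⟩
  · exact hGs.comp_contDiffOn ((hπs.comp contDiff_fst.contDiffOn fun q hq => (Set.mem_prod.1 hq).1).prodMk contDiff_snd.contDiffOn)
  · -- `δ′`: `|x_k| < π` (so that `2 arctan (tan (x_k∕2)) = x_k`) and `‖tan (x∕2)‖ < δ`
    set τ : (Fin 3 → ℝ) → (Fin 3 → ℝ) := fun x k => Real.tan (x k / 2) with hτ
    have hτc : ContinuousAt τ 0 := by
      refine continuousAt_pi.2 fun k => ?_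
      have h0 : Real.cos (0 : ℝ) ≠ 0 := by simp
      have hinc : Continuous (fun x : Fin 3 → ℝ => x k / 2) := by fun_prop
      have hin : ContinuousAt (fun x : Fin 3 → ℝ => x k / 2) 0 := hinc.continuousAt
      have htan : ContinuousAt Real.tan ((fun x : Fin 3 → ℝ => x k / 2) 0) := by
        have e : (fun x : Fin 3 → ℝ => x k / 2) 0 = 0 := by simp
        rw [e]; exact (Real.hasDerivAt_tan h0).continuousAt
      exact ContinuousAt.comp (g := Real.tan) (f := fun x : Fin 3 → ℝ => x k / 2) htan hin
    have hτ0 : τ 0 = 0 := by funext k; simp [hτ]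
    have hmem : τ ⁻¹' Metric.ball 0 δ ∈ 𝓝 (0 : Fin 3 → ℝ) := hτc.preimage_mem_nhds (by rw [hτ0]; exact Metric.isOpen_ball.mem_nhds (Metric.mem_ball_self hδ))
    obtain ⟨δ₁, hδ₁, hball⟩ := Metric.mem_nhds_iff.1 hmem
    refine ⟨min δ₁ Real.pi, lt_min hδ₁ Real.pi_pos, fun x hx z => ?_⟩
    have hx₁ : ‖x‖ < δ₁ := lt_of_lt_of_le hx (min_le_left _ _)
    have hxπ : ‖x‖ < Real.pi := lt_of_lt_of_le hx (min_le_right _ _)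
    have hτx : ‖τ x‖ < δ := by
      have := hball (by rwa [Metric.mem_ball, dist_zero_right] : x ∈ Metric.ball (0 : Fin 3 → ℝ) δ₁)
      rwa [Set.mem_preimage, Metric.mem_ball, dist_zero_right] at this
    -- `2 arctan (tan (x_k∕2)) = x_k`
    have harctan : (fun k => 2 * Real.arctan (τ x k)) = x := by
      funext k
      have hk : |x k| < Real.pi := lt_of_le_of_lt (by simpa [Real.norm_eq_abs] using norm_le_pi_norm x k) hxπ
      have h1 : -(Real.pi / 2) < x k / 2 := by have := (abs_lt.1 hk).1; linarith
      have h2 : x k / 2 < Real.pi / 2 := by have := (abs_lt.1 hk).2; linarith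
      simp only [hτ]
      rw [Real.arctan_tan h1 h2]; ring
    have hk : ∀ k, 2 * Real.arctan (τ x k) = x k := fun k => congrFun harctan k
    obtain ⟨hW, hπeq⟩ := hπ (τ x) hτx
    simp only [hk] at hW hπeq
    refine ⟨hW, ?_⟩
    show G (πt _, z) = g (x, z)
    rw [hπeq, ← hG (τ x) z]
    simp only [hgt, harctan]

end Literature.Analysis.Calculus

end
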